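import Summits.CriticalPhenomena.Ising3DConformalLimit.Theorems.HyperoctahedralRPExistsScaleCovariantLimitDecimationDefs
import Summits.CriticalPhenomena.Ising3DConformalLimit.Theorems.HyperoctahedralRPExistsScaleCovariantLimitDecimationEndpointIdentity
import Literature.Probability.LatticeModels.GaussianPairingBoundCouplings
import Literature.Probability.LatticeModels.CriticalCorrWellDefined
import HarnessLib

/-!
# Griffiths inequalities for the two-coupling (n.n. `K` + sublattice range-`p` `J`) ferromagnet on free boxes

Crux `ExistsScaleCovariantLimit` (stmt-CriticalPhenomena-1981), line `decimation-homotopy-rate` (lead c8), scaffolding of the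
line's research stubs `PathLipschitz 2/3`: the objects of the conjecture — the finite-volume averages `boxAvg p N K J x` of the
two-coupling model on the free box `Λ_N`, their infinite-volume limits (`subPair`), and the susceptibility-critical curve `Jcrit` —
are shown to be honest, i.e. the `limUnder` in `subPair` is a genuine limit, by the standard GKS route (Friedli–Velenik 2017,
Thm. 3.20, Exercises 3.12, 3.16, 3.31), here for `PairIsing.gibbsAvg` with the nonnegative coupling matrix `decimationCoupling`:

* `exists_boxMonomial_eq_spinProduct` — the box monomial `∏ᵢ σ_{xᵢ}` (junk factor `1` off the box) is a spin product `σ_A`;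
* `boxAvg_nonneg` (GKS I), `boxAvg_mono_couplings` (Griffiths' comparison in `K`, `J`), `boxAvg_mono_volume`
  (GKS II in the volume: `Λ_N ↦ Λ_{N+1}` is a comparison of couplings after marginalising the free shell spins,
  `EndpointIdentityProof.gibbsAvg_restrict`), `abs_boxAvg_le_one`;
* `tendsto_boxAvg` — for `K, J ≥ 0` the free box averages converge as `N → ∞` (eventually monotone and bounded), hence
  `tendsto_subPair` : `⟨σ₀σ_{px}⟩_{Λ_N;K,J} → subPair p K J x` (registered sub-goal), `subPair_nonneg`, `subPair_mono`.

Sources: S. Friedli, Y. Velenik, *Statistical Mechanics of Lattice Systems* (CUP 2017) §3.6–§3.8; R. B. Griffiths, J. Math. Phys. 8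
(1967); D. G. Kelly, S. Sherman, J. Math. Phys. 9 (1968).
-/

noncomputable section

open Filter Topology Finset
open scoped BigOperators
open Literature.Probability.LatticeModels
open Classical

namespace Summit.CriticalPhenomena.Ising3DConformalLimit.Cruxes.ExistsScaleCovariantLimit.DecimationHomotopyRate

namespace TwoCouplingGKS

/-! ## Box monomials are spin products -/

/-- A finite product of spins `∏_{j ∈ s} σ_{v j}` over any index finset is a spin product `σ_A` (`σ² = 1`). [folklore] -/
theorem exists_prod_spinAt_eq_spinProduct {V κ : Type*} [DecidableEq V] (s : Finset κ) (v : κ → V) :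
    ∃ A : Finset V, (fun σ : SpinConfig V => ∏ j ∈ s, spinAt (v j) σ) = spinProduct A := by
  obtain ⟨A, hA⟩ := exists_spinMonomial_eq_spinProduct (fun i : Fin s.card => v (s.equivFin.symm i))
  refine ⟨A, funext fun σ => ?_⟩
  show (∏ j ∈ s, spinAt (v j) σ) = spinProduct A σ
  rw [← congrFun hA σ, spinMonomial, ← Finset.prod_coe_sort s]
  exact Fintype.prod_equiv s.equivFin _ _ fun j => by simp

/-- **The box monomial is a spin product** of box sites: `boxMonomial N x = σ_A` for some `A ⊆ Λ_N`. [folklore] -/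
theorem exists_boxMonomial_eq_spinProduct (N : ℕ) {n : ℕ} (x : Fin n → Site 3) :
    ∃ A : Finset ↥(box 3 N), boxMonomial N x = spinProduct A := by
  -- indices whose site lies in the box, as the universe of a subtype carrying the membership proof
  obtain ⟨A, hA⟩ := exists_prod_spinAt_eq_spinProduct (V := ↥(box 3 N))
    (univ : Finset {i : Fin n // x i ∈ box 3 N}) (fun j => (⟨x j.1, j.2⟩ : ↥(box 3 N)))
  refine ⟨A, ?_⟩
  rw [← hA]
  funext σ
  show (∏ i, (if h : x i ∈ box 3 N then spinAt (⟨x i, h⟩ : ↥(box 3 N)) σ else 1)) =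
    ∏ j : {i : Fin n // x i ∈ box 3 N}, spinAt (⟨x j.1, j.2⟩ : ↥(box 3 N)) σ
  have h2 : ∏ i : {i : Fin n // ¬ x i ∈ box 3 N},
      (if h : x i.1 ∈ box 3 N then spinAt (⟨x i.1, h⟩ : ↥(box 3 N)) σ else 1) = 1 :=
    Finset.prod_eq_one fun i _ => dif_neg i.2
  rw [← Fintype.prod_subtype_mul_prod_subtype (fun i : Fin n => x i ∈ box 3 N), h2, mul_one]
  exact Finset.prod_congr rfl fun i _ => dif_pos i.2

/-! ## GKS for `PairIsing.gibbsAvg` (through the `rfl` bridge to `PairIsing.avg` and `avg_eq_gksExpect`) -/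

/-- The light-module average IS the original one (syntactically identical definitions). [folklore] -/
theorem gibbsAvg_eq_avg {ι : Type*} [Fintype ι] [DecidableEq ι] (c : ι → ι → ℝ) (f : SpinConfig ι → ℝ) :
    PairIsing.gibbsAvg c f = PairIsing.avg c f := rfl

/-- GKS I: `⟨σ_A⟩_c ≥ 0` for a nonnegative coupling matrix. [cite: FriedliVelenik2017, Thm. 3.49, eq. (3.54)] -/
theorem gibbsAvg_spinProduct_nonneg {ι : Type*} [Fintype ι] [DecidableEq ι] {c : ι → ι → ℝ}
    (hc : ∀ a b, 0 ≤ c a b) (A : Finset ι) : 0 ≤ PairIsing.gibbsAvg c (spinProduct A) := by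
  rw [gibbsAvg_eq_avg]
  exact PairIsing.avg_spinProduct_nonneg hc A

/-- Griffiths' comparison: `|c'| ≤ c` entrywise ⟹ `⟨σ_A⟩_{c'} ≤ ⟨σ_A⟩_c`. [cite: FriedliVelenik2017, Exercise 3.31, p. 142] -/
theorem gibbsAvg_spinProduct_mono {ι : Type*} [Fintype ι] [DecidableEq ι] {c c' : ι → ι → ℝ}
    (h : ∀ a b, |c' a b| ≤ c a b) (A : Finset ι) :
    PairIsing.gibbsAvg c' (spinProduct A) ≤ PairIsing.gibbsAvg c (spinProduct A) := by
  rw [gibbsAvg_eq_avg, gibbsAvg_eq_avg, PairIsing.avg_eq_gksExpect, PairIsing.avg_eq_gksExpect]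
  exact gksExpect_mono_of_abs_le _ _ (fun i _ => h i.1 i.2) A

/-- `|⟨f⟩_c| ≤ 1` when `|f| ≤ 1`. [folklore] -/
theorem abs_gibbsAvg_le_one {ι : Type*} [Fintype ι] [DecidableEq ι] (c : ι → ι → ℝ) {f : SpinConfig ι → ℝ}
    (hf : ∀ σ, |f σ| ≤ 1) : |PairIsing.gibbsAvg c f| ≤ 1 :=
  (PairIsing.abs_gibbsAvg_le c f).trans
    ((PairIsing.gibbsAvg_mono c hf).trans (PairIsing.gibbsAvg_const c 1).le)

/-- `|σ_A| ≤ 1`. [folklore] -/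
theorem abs_spinProduct_le_one {V : Type*} (A : Finset V) (σ : SpinConfig V) : |spinProduct A σ| ≤ 1 := by
  rw [spinProduct, Finset.abs_prod]
  refine Finset.prod_le_one (fun _ _ => abs_nonneg _) fun v _ => ?_
  rw [abs_spinAt]

/-! ## The two-coupling matrix: sign and comparison -/

/-- `decimationCoupling p N K J ≥ 0` entrywise for `K, J ≥ 0`. [folklore] -/
theorem decimationCoupling_nonneg (p N : ℕ) {K J : ℝ} (hK : 0 ≤ K) (hJ : 0 ≤ J) (a b : ↥(box 3 N)) :
    0 ≤ decimationCoupling p N K J a b := by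
  unfold decimationCoupling
  split_ifs <;> linarith

/-- Entrywise comparison `|decimationCoupling p N K J| ≤ decimationCoupling p N K' J'` for `0 ≤ K ≤ K'`, `0 ≤ J ≤ J'`. [folklore] -/
theorem decimationCoupling_abs_le (p N : ℕ) {K K' J J' : ℝ} (hK : 0 ≤ K) (hKK' : K ≤ K') (hJ : 0 ≤ J)
    (hJJ' : J ≤ J') (a b : ↥(box 3 N)) :
    |decimationCoupling p N K J a b| ≤ decimationCoupling p N K' J' a b := by
  unfold decimationCoupling
  split_ifs
  · rw [abs_of_nonneg (by linarith)]; linarith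
  · rw [abs_of_nonneg (by linarith)]; linarith
  · simp

/-! ## GKS I and Griffiths' comparison for `boxAvg` -/

/-- **GKS I for the two-coupling model**: `boxAvg p N K J x ≥ 0` for `K, J ≥ 0`. [cite: FriedliVelenik2017, Thm. 3.20] -/
theorem boxAvg_nonneg (p N : ℕ) {K J : ℝ} (hK : 0 ≤ K) (hJ : 0 ≤ J) {n : ℕ} (x : Fin n → Site 3) :
    0 ≤ boxAvg p N K J x := by
  obtain ⟨A, hA⟩ := exists_boxMonomial_eq_spinProduct N x
  rw [boxAvg, hA]
  exact gibbsAvg_spinProduct_nonneg (decimationCoupling_nonneg p N hK hJ) A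

/-- `|boxAvg p N K J x| ≤ 1`. [folklore] -/
theorem abs_boxAvg_le_one (p N : ℕ) (K J : ℝ) {n : ℕ} (x : Fin n → Site 3) : |boxAvg p N K J x| ≤ 1 := by
  obtain ⟨A, hA⟩ := exists_boxMonomial_eq_spinProduct N x
  rw [boxAvg, hA]
  exact abs_gibbsAvg_le_one _ (abs_spinProduct_le_one A)

/-- **Griffiths' comparison in the couplings**: `boxAvg p N K J x ≤ boxAvg p N K' J' x` for `0 ≤ K ≤ K'`, `0 ≤ J ≤ J'`.
[cite: FriedliVelenik2017, Exercise 3.31, p. 142] -/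
theorem boxAvg_mono_couplings (p N : ℕ) {K K' J J' : ℝ} (hK : 0 ≤ K) (hKK' : K ≤ K') (hJ : 0 ≤ J) (hJJ' : J ≤ J')
    {n : ℕ} (x : Fin n → Site 3) : boxAvg p N K J x ≤ boxAvg p N K' J' x := by
  obtain ⟨A, hA⟩ := exists_boxMonomial_eq_spinProduct N x
  rw [boxAvg, boxAvg, hA]
  exact gibbsAvg_spinProduct_mono (decimationCoupling_abs_le p N hK hKK' hJ hJJ') A


/-! ## GKS II in the volume: `boxAvg p N K J x ≤ boxAvg p (N+1) K J x` -/

/-- `Λ_N ⊆ Λ_{N+1}`. [folklore] -/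
theorem box_subset_box_succ (N : ℕ) : box 3 N ⊆ box 3 (N + 1) := by
  intro y hy
  rw [mem_box] at hy ⊢
  intro i
  have := hy i
  push_cast
  omega

/-- **GKS II in the volume** (Friedli–Velenik Exercise 3.12 for the two-coupling model): for `K, J ≥ 0` and a monomial whose sites all
lie in `Λ_N`, `boxAvg p N K J x ≤ boxAvg p (N+1) K J x`. Proof: the `Λ_N`-model is the `Λ_{N+1}`-model with every coupling touching the
shell `Λ_{N+1} \ Λ_N` switched off (the shell spins are then free and integrate out, `EndpointIdentityProof.gibbsAvg_restrict`), and
switching them on is Griffiths' comparison. [cite: FriedliVelenik2017, Exercise 3.12] -/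
theorem boxAvg_mono_volume (p N : ℕ) {K J : ℝ} (hK : 0 ≤ K) (hJ : 0 ≤ J) {n : ℕ} {x : Fin n → Site 3}
    (hx : ∀ i, x i ∈ box 3 N) : boxAvg p N K J x ≤ boxAvg p (N + 1) K J x := by
  -- the truncated couplings on `Λ_{N+1}`
  set c : ↥(box 3 (N + 1)) → ↥(box 3 (N + 1)) → ℝ := decimationCoupling p (N + 1) K J with hc
  set ct : ↥(box 3 (N + 1)) → ↥(box 3 (N + 1)) → ℝ := fun a b =>
    if a.1 ∈ box 3 N ∧ b.1 ∈ box 3 N then c a b else 0 with hct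
  obtain ⟨A, hA⟩ := exists_boxMonomial_eq_spinProduct (N + 1) x
  -- (1) comparison of couplings on `Λ_{N+1}`
  have hcmp : PairIsing.gibbsAvg ct (boxMonomial (N + 1) x) ≤ boxAvg p (N + 1) K J x := by
    rw [boxAvg, hA]
    refine gibbsAvg_spinProduct_mono (fun a b => ?_) A
    simp only [hct]
    split_ifs
    · exact (abs_of_nonneg (decimationCoupling_nonneg p (N + 1) hK hJ a b)).le
    · rw [abs_zero]; exact decimationCoupling_nonneg p (N + 1) hK hJ a b
  -- (2) the truncated model marginalises to the `Λ_N`-model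
  have hmarg : PairIsing.gibbsAvg ct (boxMonomial (N + 1) x) = boxAvg p N K J x := by
    have hx' : ∀ i, x i ∈ box 3 (N + 1) := fun i => box_subset_box_succ N (hx i)
    rw [EndpointIdentityProof.gibbsAvg_restrict (fun a : ↥(box 3 (N + 1)) => a.1 ∈ box 3 N) ct
      (fun a b hab => by simp only [hct]; exact if_neg hab) (boxMonomial (N + 1) x)
      (fun τ => ∏ i, spinAt (⟨⟨x i, hx' i⟩, hx i⟩ : {a : ↥(box 3 (N + 1)) // a.1 ∈ box 3 N}) τ)
      (fun σ => by
        unfold boxMonomial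
        exact Finset.prod_congr rfl fun i _ => by rw [dif_pos (hx' i)]; rfl)]
    -- transport along the copy `{a ∈ Λ_{N+1} // a ∈ Λ_N} ≃ Λ_N`
    let e : {a : ↥(box 3 (N + 1)) // a.1 ∈ box 3 N} ≃ ↥(box 3 N) :=
      ⟨fun a => ⟨a.1.1, a.2⟩, fun b => ⟨⟨b.1, box_subset_box_succ N b.2⟩, b.2⟩, fun _ => rfl, fun _ => rfl⟩
    rw [boxAvg, ← PairIsing.gibbsAvg_comp_equiv e (decimationCoupling p N K J) (boxMonomial N x)]
    congr 1
    · funext a b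
      simp only [hct, hc]
      rw [if_pos ⟨a.2, b.2⟩]
      rfl
    · funext τ
      unfold boxMonomial
      refine Finset.prod_congr rfl fun i _ => ?_
      rw [dif_pos (hx i)]
      rfl
  rw [← hmarg]
  exact hcmp

/-- Volume monotonicity along `N ≤ N'` once all sites are inside `Λ_N`. [cite: FriedliVelenik2017, Exercise 3.12] -/
theorem boxAvg_mono_volume_of_le (p : ℕ) {K J : ℝ} (hK : 0 ≤ K) (hJ : 0 ≤ J) {n : ℕ} {x : Fin n → Site 3} {N N' : ℕ}
    (hx : ∀ i, x i ∈ box 3 N) (hNN' : N ≤ N') : boxAvg p N K J x ≤ boxAvg p N' K J x := by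
  induction hNN' with
  | refl => exact le_rfl
  | @step M hNM ih =>
    have hNM' : N ≤ M := hNM
    exact ih.trans (boxAvg_mono_volume p M hK hJ fun i => by
      have h := hx i
      rw [mem_box] at h ⊢
      intro j; have := h j; omega)

/-! ## The thermodynamic limit of the free box averages exists -/

/-- **Existence of the free state of the two-coupling model on monomials**: for `K, J ≥ 0` the box averages `boxAvg p N K J x`
converge as `N → ∞` (eventually nondecreasing by GKS II in the volume, bounded by `1`). [cite: FriedliVelenik2017, Exercise 3.16] -/
theorem tendsto_boxAvg (p : ℕ) {K J : ℝ} (hK : 0 ≤ K) (hJ : 0 ≤ J) {n : ℕ} (x : Fin n → Site 3) :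
    ∃ ℓ : ℝ, Tendsto (fun N : ℕ => boxAvg p N K J x) atTop (𝓝 ℓ) := by
  -- a volume containing all sites
  obtain ⟨N₁, hN₁⟩ : ∃ N₁ : ℕ, ∀ i, x i ∈ box 3 N₁ := by
    have h := (eventually_all.2 fun i => eventually_mem_box (d := 3) (x i)).exists
    exact h
  have hmono : Monotone fun M : ℕ => boxAvg p (M + N₁) K J x := by
    refine monotone_nat_of_le_succ fun M => ?_
    have hx : ∀ i, x i ∈ box 3 (M + N₁) := fun i => by
      have h := hN₁ i
      rw [mem_box] at h ⊢
      intro j; have := h j; push_cast; omega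
    simpa [Nat.add_right_comm] using boxAvg_mono_volume p (M + N₁) hK hJ hx
  have hbdd : BddAbove (Set.range fun M : ℕ => boxAvg p (M + N₁) K J x) :=
    ⟨1, by rintro _ ⟨M, rfl⟩; exact (le_abs_self _).trans (abs_boxAvg_le_one p _ K J x)⟩
  refine ⟨⨆ M : ℕ, boxAvg p (M + N₁) K J x, ?_⟩
  exact (Filter.tendsto_add_atTop_iff_nat N₁).1 (tendsto_atTop_ciSup hmono hbdd)

/-- **The sublattice pair function is a genuine limit** (registered sub-goal): for `K, J ≥ 0`,
`⟨σ₀σ_{px}⟩_{Λ_N;K,J} → subPair p K J x` as `N → ∞`. [cite: FriedliVelenik2017, Exercise 3.16] -/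
theorem tendsto_subPair :
    ∀ (p : ℕ) (K J : ℝ), 0 ≤ K → 0 ≤ J → ∀ x : Site 3,
      Tendsto (fun N : ℕ => boxAvg p N K J ![0, (p : ℤ) • x]) atTop (𝓝 (subPair p K J x)) := by
  intro p K J hK hJ x
  exact tendsto_nhds_limUnder (tendsto_boxAvg p hK hJ _)

/-- `subPair p K J x ≥ 0` for `K, J ≥ 0`. [cite: FriedliVelenik2017, Thm. 3.20] -/
theorem subPair_nonneg (p : ℕ) {K J : ℝ} (hK : 0 ≤ K) (hJ : 0 ≤ J) (x : Site 3) : 0 ≤ subPair p K J x :=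
  ge_of_tendsto' (tendsto_subPair p K J hK hJ x) fun N => boxAvg_nonneg p N hK hJ _

/-- **Monotonicity of the sublattice pair function in both couplings**: `subPair p K J ≤ subPair p K' J'` for `0 ≤ K ≤ K'`,
`0 ≤ J ≤ J'`. [cite: FriedliVelenik2017, Exercise 3.31, p. 142] -/
theorem subPair_mono (p : ℕ) {K K' J J' : ℝ} (hK : 0 ≤ K) (hKK' : K ≤ K') (hJ : 0 ≤ J) (hJJ' : J ≤ J') (x : Site 3) :
    subPair p K J x ≤ subPair p K' J' x :=
  le_of_tendsto_of_tendsto' (tendsto_subPair p K J hK hJ x) (tendsto_subPair p K' J' (hK.trans hKK') (hJ.trans hJJ') x)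
    fun N => boxAvg_mono_couplings p N hK hKK' hJ hJJ' _

/-- `subPair p K J x ≤ 1`. [folklore] -/
theorem subPair_le_one (p : ℕ) {K J : ℝ} (hK : 0 ≤ K) (hJ : 0 ≤ J) (x : Site 3) : subPair p K J x ≤ 1 :=
  le_of_tendsto' (tendsto_subPair p K J hK hJ x) fun N => (le_abs_self _).trans (abs_boxAvg_le_one p N K J _)

end TwoCouplingGKS

end Summit.CriticalPhenomena.Ising3DConformalLimit.Cruxes.ExistsScaleCovariantLimit.DecimationHomotopyRate

end
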